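import Summits.QuantumFields.YangMills.Theorems.LangevinControlUVOSLegsFromFemtoAndGapStubAssemblyPlaneStrings
import Summits.QuantumFields.YangMills.Theorems.HypercubicLimit.Negative.ReflectedDensity
import HarnessLib

/-!
# Soft OS-assembly toolkit XVII: the reflection-positivity square of the smeared plane-string fields

Helper file for stub `stub_assembly6` of crux `OSLegsFromFemtoAndGap` (stmt-QuantumFields-9367, line
`dlr-collar-transfer`, reshape r2).  On the odd torus of side `2L+1` (time slices `−L … L` in the box
coordinates of toolkit III, reflection `θ t = 1 − t` of the tree's `GaugeConfig.timeReflect`):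
* `plane_torusLift`: the plane field read through the lift is the tree's `torusPlaquette`; hence the EXACT
  reflection law `plane_torusLift_timeReflect`: `plane q x (lift ΘU) = plane q (θ̃_q x) (lift U)` with
  `θ̃_q x = θ_ℤ x − [q.1 = 0] e₀` (`thetaSite`; temporal plaquettes hang down), an involution;
* `strObs q m y` — the centred plane STRING observable `∏ₗ (plane (q l) (y l) ∘ lift − m l)`, its reflection law,
  measurability, bound, and support on the closed positive half `P ∪ M` of
  `wilsonExpectation_oddReflectionPositive` when every site has `1 ≤ y_l⁰ ≤ L` (`dependsOn_strObs`);
* `fieldObs a F m` — the smeared field `Σ_{q valid} Σ_{y ∈ boxⁿ} F(a y) ∏ₗ(plane − m)` of a test function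
  vanishing at non-positive times, and **`re_rpSquare_nonneg`**: for finitely many such fields
  `0 ≤ Re E[conj X(ΘU) X(U)]`, `Im = 0`, `X = Σⱼ fieldObs a Fⱼ m` — the lattice input of E2.
-/

noncomputable section

open scoped SchwartzMap BigOperators ComplexConjugate ComplexOrder
open MeasureTheory Filter Topology
open Literature.MathematicalPhysics.QuantumFieldTheory Literature.MathematicalPhysics.QuantumLattice
open Literature.MathematicalPhysics.AQFT
open Literature.Probability.LatticeModels (box Site mem_box)
open Literature.Probability.LatticeModels.Torus (proj)
open Summit.QuantumFields.YangMills.Cruxes.OSLegsFromFemtoAndGap.DlrCollarTransfer (plane exists_abs_plane_le)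
open Summit.QuantumFields.YangMills.Theorems.HypercubicLimit.Negative
  (torusPlaquette thetaZ thetaZ_apply_zero thetaZ_apply_of_ne torusPlaquette_timeReflect_temporal
    torusPlaquette_timeReflect_spatial measurable_torusPlaquette dependsOn_torusPlaquette val_proj_zero)

namespace Summit.QuantumFields.YangMills.Theorems.OSLegsFromFemtoAndGap

local notation "E4" => EuclideanSpace ℝ (Fin 4)

variable {G : Type} [Group G] [TopologicalSpace G] [IsTopologicalGroup G] [CompactSpace G]
  [MeasurableSpace G] [BorelSpace G]

/-! ### The plane fields through the lift, and their exact reflection law -/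

omit [IsTopologicalGroup G] [CompactSpace G] [BorelSpace G] in
/-- The plane field read through the periodic lift is the tree's torus plaquette. -/
theorem plane_torusLift (r : LatticeRep G) (L : ℕ) (q : Fin 4 × Fin 4) (x : Site 4) (U : GaugeConfig 4 L G) :
    plane G r q x (torusLift L U) = torusPlaquette r L q.1 q.2 x U := by
  unfold torusPlaquette plane plaquetteObs
  rw [CurvatureBoostCovariance.Negative.plaquetteHolonomyZd_torusLift']
  have h : plaquetteHolonomyZd (configShift (-x) (torusLift L U)) 0 q.1 q.2 =
      plaquetteHolonomyZd (torusLift L U) x q.1 q.2 := by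
    simp [plaquetteHolonomyZd, configShift_apply, add_comm]
  rw [h, CurvatureBoostCovariance.Negative.plaquetteHolonomyZd_torusLift']

/-- **The reflected site** of orientation `q`: `θ̃_q x = θ_ℤ x − [q.1 = 0] e₀`. -/
def thetaSite (q : Fin 4 × Fin 4) (x : Site 4) : Site 4 :=
  thetaZ x - if q.1 = 0 then Pi.single 0 1 else 0

/-- Time coordinate of the reflected site. -/
theorem thetaSite_apply_zero (q : Fin 4 × Fin 4) (x : Site 4) :
    thetaSite q x 0 = 1 - x 0 - if q.1 = 0 then 1 else 0 := by
  unfold thetaSite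
  split_ifs <;> simp

/-- Spatial coordinates of the reflected site. -/
theorem thetaSite_apply_of_ne (q : Fin 4 × Fin 4) (x : Site 4) {k : Fin 4} (hk : k ≠ 0) :
    thetaSite q x k = x k := by
  unfold thetaSite
  split_ifs <;> simp [thetaZ_apply_of_ne x hk, hk]

/-- `θ̃_q` is an involution. -/
theorem thetaSite_thetaSite (q : Fin 4 × Fin 4) (x : Site 4) : thetaSite q (thetaSite q x) = x := by
  ext k
  by_cases hk : k = 0
  · subst hk; rw [thetaSite_apply_zero, thetaSite_apply_zero]; ring
  · rw [thetaSite_apply_of_ne q _ hk, thetaSite_apply_of_ne q _ hk]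

omit [BorelSpace G] in
/-- **Exact reflection law of the plane fields**: `plane q x (lift ΘU) = plane q (θ̃_q x) (lift U)` (`q.1 < q.2`). -/
theorem plane_torusLift_timeReflect (r : LatticeRep G) (L : ℕ) {q : Fin 4 × Fin 4} (hq : q.1 < q.2) (x : Site 4)
    (U : GaugeConfig 4 L G) :
    plane G r q x (torusLift L U.timeReflect) = plane G r q (thetaSite q x) (torusLift L U) := by
  rw [plane_torusLift, plane_torusLift]
  unfold thetaSite
  by_cases h0 : q.1 = 0
  · have hq' : (0 : Fin 4) < q.2 := h0 ▸ hq
    rw [h0, if_pos rfl]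
    exact torusPlaquette_timeReflect_temporal r L hq' x U
  · rw [if_neg h0, sub_zero]
    exact torusPlaquette_timeReflect_spatial r L (Fin.pos_iff_ne_zero.2 h0) hq x U

/-! ### The centred plane-string observable -/

/-- **Centred plane-string observable** on the torus of side `2L+1`: `∏ₗ (plane (q l) (y l) (lift U) − m l)`. -/
def strObs (r : LatticeRep G) (L : ℕ) {n : ℕ} (q : Fin n → Fin 4 × Fin 4) (m : Fin n → ℝ)
    (y : Fin n → Site 4) (U : GaugeConfig 4 (2 * L + 1) G) : ℝ :=
  ∏ l, (plane G r (q l) (y l) (torusLift (2 * L + 1) U) - m l)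

omit [BorelSpace G] in
/-- **Reflection law of the string observable.** -/
theorem strObs_timeReflect (r : LatticeRep G) (L : ℕ) {n : ℕ} {q : Fin n → Fin 4 × Fin 4}
    (hq : ∀ l, (q l).1 < (q l).2) (m : Fin n → ℝ) (y : Fin n → Site 4) (U : GaugeConfig 4 (2 * L + 1) G) :
    strObs r L q m y U.timeReflect = strObs r L q m (fun l => thetaSite (q l) (y l)) U := by
  unfold strObs
  refine Finset.prod_congr rfl fun l _ => ?_
  dsimp only
  rw [plane_torusLift_timeReflect r _ (hq l)]

/-- The string observable is measurable. -/
theorem measurable_strObs (r : LatticeRep G) (L : ℕ) {n : ℕ} (q : Fin n → Fin 4 × Fin 4) (m : Fin n → ℝ)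
    (y : Fin n → Site 4) : Measurable (strObs r L q m y) := by
  unfold strObs
  refine Finset.measurable_prod _ fun l _ => ?_
  simp_rw [plane_torusLift]
  exact (measurable_torusPlaquette r _ _ _ _).sub measurable_const

omit [IsTopologicalGroup G] [CompactSpace G] [BorelSpace G] in
/-- The string observable is bounded: `|strObs| ≤ (Cₚ + Cₘ)ⁿ` if `|plane| ≤ Cₚ`, `|m l| ≤ Cₘ`. -/
theorem abs_strObs_le (r : LatticeRep G) (L : ℕ) {n : ℕ} (q : Fin n → Fin 4 × Fin 4) {m : Fin n → ℝ} {Cp Cm : ℝ}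
    (hCp : ∀ (q : Fin 4 × Fin 4) (x : Fin 4 → ℤ) (U : LGConfig 4 G), |plane G r q x U| ≤ Cp)
    (hCm : ∀ l, |m l| ≤ Cm) (y : Fin n → Site 4) (U : GaugeConfig 4 (2 * L + 1) G) :
    |strObs r L q m y U| ≤ (Cp + Cm) ^ n := by
  unfold strObs
  rw [Finset.abs_prod]
  calc _ ≤ ∏ _l : Fin n, (Cp + Cm) := Finset.prod_le_prod (fun _ _ => abs_nonneg _) fun l _ =>
        (abs_sub _ _).trans (add_le_add (hCp _ _ _) (hCm l))
    _ = (Cp + Cm) ^ n := by simp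

/-! ### Support on the closed positive half -/

/-- **The four links of a plaquette based in the slices `1 ≤ t ≤ L` lie in `P ∪ M`** of the odd torus of side `2L+1`
(generalising the tree's `plaquette_edges_subset_pos_union_shared`). -/
theorem plaquette_edges_subset {L : ℕ} (hL : 1 ≤ L) {y : Site 4} (hy1 : 1 ≤ y 0) (hyL : y 0 ≤ L)
    {i j : Fin 4} (hij : i < j) :
    ({torusEdge (2 * L + 1) (y, i), torusEdge (2 * L + 1) (y + Pi.single i 1, j),
      torusEdge (2 * L + 1) (y + Pi.single j 1, i), torusEdge (2 * L + 1) (y, j)} : Set (Edge 4 (2 * L + 1))) ⊆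
      ((WilsonOddRP.oPosEdges ∪ WilsonOddRP.oSharedEdges : Finset (Edge 4 (2 * L + 1))) :
        Set (Edge 4 (2 * L + 1))) := by
  haveI : Fact (1 < 2 * L + 1) := ⟨by omega⟩
  have hL2 : (2 * L + 1) / 2 = L := by omega
  obtain ⟨t, ht⟩ : ∃ t : ℕ, y 0 = t := ⟨(y 0).toNat, (Int.toNat_of_nonneg (by omega)).symm⟩
  have ht1 : 1 ≤ t := by omega
  have htL : t ≤ L := by omega
  have hj0 : j ≠ 0 := fun h => by rw [h] at hij; exact absurd hij (Fin.not_lt.2 (Fin.zero_le _))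
  have hy : (proj (2 * L + 1) y 0).val = t := val_proj_zero ht (by omega)
  have hyj : (proj (2 * L + 1) (y + Pi.single j 1) 0).val = t :=
    val_proj_zero (by simp [ht, Ne.symm hj0]) (by omega)
  intro e he
  simp only [Set.mem_insert_iff, Set.mem_singleton_iff] at he
  rw [Finset.coe_union, Set.mem_union, Finset.mem_coe, Finset.mem_coe, WilsonOddRP.mem_oPosEdges,
    WilsonOddRP.mem_oSharedEdges, WilsonOddRP.IsOPosEdge, WilsonOddRP.IsOSharedEdge, hL2]
  rcases he with rfl | rfl | rfl | rfl
  · left; simp only [torusEdge]; rw [hy]; exact ⟨ht1, htL⟩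
  · by_cases hi0 : i = 0
    · subst hi0
      have hy0 : (proj (2 * L + 1) (y + Pi.single 0 1) 0).val = t + 1 :=
        val_proj_zero (t := t + 1) (by simp [ht]) (by omega)
      simp only [torusEdge]
      rw [hy0]
      rcases Nat.lt_or_ge t L with h | h
      · left; exact ⟨by omega, h⟩
      · right; exact ⟨hj0, by omega⟩
    · have hyi : (proj (2 * L + 1) (y + Pi.single i 1) 0).val = t :=
        val_proj_zero (by simp [ht, hi0]) (by omega)
      left; simp only [torusEdge]; rw [hyi]; exact ⟨ht1, htL⟩
  · left; simp only [torusEdge]; rw [hyj]; exact ⟨ht1, htL⟩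
  · left; simp only [torusEdge]; rw [hy]; exact ⟨ht1, htL⟩

omit [IsTopologicalGroup G] [CompactSpace G] [BorelSpace G] in
/-- **Support of the string observable**: if every site has `1 ≤ y_l⁰ ≤ L`, `strObs` depends only on the links of
the closed positive half `P ∪ M`. -/
theorem dependsOn_strObs (r : LatticeRep G) {L : ℕ} (hL : 1 ≤ L) {n : ℕ} {q : Fin n → Fin 4 × Fin 4}
    (hq : ∀ l, (q l).1 < (q l).2) (m : Fin n → ℝ) {y : Fin n → Site 4} (hy : ∀ l, 1 ≤ y l 0 ∧ y l 0 ≤ L) :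
    DependsOn (strObs r L q m y)
      ((WilsonOddRP.oPosEdges ∪ WilsonOddRP.oSharedEdges : Finset (Edge 4 (2 * L + 1))) : Set (Edge 4 (2 * L + 1))) := by
  intro U V hUV
  unfold strObs
  refine Finset.prod_congr rfl fun l _ => ?_
  rw [plane_torusLift, plane_torusLift]
  congr 1
  exact dependsOn_torusPlaquette r (2 * L + 1) (q l).1 (q l).2 (y l) fun e he =>
    hUV e (plaquette_edges_subset hL (hy l).1 (hy l).2 (hq l) he)

/-! ### The smeared field and the reflection-positivity square -/

/-- Membership in the set of valid plane strings. -/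
theorem mem_planeStrings_iff'' {n : ℕ} (q : Fin n → Fin 4 × Fin 4) :
    q ∈ Fintype.piFinset (fun _ : Fin n => Finset.univ.filter fun p : Fin 4 × Fin 4 => p.1 < p.2) ↔
      ∀ i, (q i).1 < (q i).2 := by
  simp [Fintype.mem_piFinset]

/-- Finite sums of functions depending only on `s` depend only on `s`. -/
theorem dependsOn_finset_sum' {ι α β M : Type*} [AddCommMonoid M] {s : Set α} (t : Finset ι)
    {f : ι → (α → β) → M} (h : ∀ i ∈ t, DependsOn (f i) s) : DependsOn (fun U => ∑ i ∈ t, f i U) s :=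
  fun _ _ hUV => Finset.sum_congr rfl fun i hi => h i hi hUV

/-- **Smeared plane-string field** of a test function on the torus of side `2L+1` at spacing `a`:
`Σ_{q valid} Σ_{y ∈ boxⁿ} F(a y) ∏ₗ (plane (q l)(y l) − m (q l))`. -/
def fieldObs (r : LatticeRep G) (L : ℕ) (a : ℝ) {n : ℕ} (F : 𝓢((Fin n → E4), ℂ)) (m : Fin 4 × Fin 4 → ℝ)
    (U : GaugeConfig 4 (2 * L + 1) G) : ℂ :=
  ∑ q ∈ Fintype.piFinset (fun _ : Fin n => Finset.univ.filter fun p : Fin 4 × Fin 4 => p.1 < p.2),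
    ∑ y ∈ Fintype.piFinset (fun _ : Fin n => box 4 L),
      F (fun l => a • siteToE (y l)) * (strObs r L q (fun l => m (q l)) y U : ℂ)

/-- The smeared field is measurable. -/
theorem measurable_fieldObs (r : LatticeRep G) (L : ℕ) (a : ℝ) {n : ℕ} (F : 𝓢((Fin n → E4), ℂ))
    (m : Fin 4 × Fin 4 → ℝ) : Measurable (fieldObs r L a F m) := by
  unfold fieldObs
  refine Finset.measurable_sum _ fun q _ => Finset.measurable_sum _ fun y _ => ?_
  exact (Complex.measurable_ofReal.comp (measurable_strObs r L q _ y)).const_mul _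

omit [BorelSpace G] in
/-- The smeared field is bounded. -/
theorem exists_norm_fieldObs_le (r : LatticeRep G) (L : ℕ) (a : ℝ) {n : ℕ} (F : 𝓢((Fin n → E4), ℂ))
    (m : Fin 4 × Fin 4 → ℝ) : ∃ C : ℝ, ∀ U, ‖fieldObs r L a F m U‖ ≤ C := by
  obtain ⟨Cp, hCp⟩ := exists_abs_plane_le (G := G) r
  set Cm : ℝ := ∑ q : Fin 4 × Fin 4, |m q|
  have hCm : ∀ q, |m q| ≤ Cm := fun q =>
    Finset.single_le_sum (f := fun q => |m q|) (fun _ _ => abs_nonneg _) (Finset.mem_univ q)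
  obtain ⟨CF, hCF⟩ : ∃ CF, ∀ x, ‖F x‖ ≤ CF := ⟨SchwartzMap.seminorm ℂ 0 0 F, fun x => by
    have := SchwartzMap.le_seminorm ℂ 0 0 F x; rwa [pow_zero, one_mul, norm_iteratedFDeriv_zero] at this⟩
  refine ⟨∑ q ∈ Fintype.piFinset (fun _ : Fin n => Finset.univ.filter fun p : Fin 4 × Fin 4 => p.1 < p.2),
    ∑ _y ∈ Fintype.piFinset (fun _ : Fin n => box 4 L), CF * (Cp + Cm) ^ n, fun U => ?_⟩
  unfold fieldObs
  refine (norm_sum_le _ _).trans (Finset.sum_le_sum fun q _ => (norm_sum_le _ _).trans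
    (Finset.sum_le_sum fun y _ => ?_))
  rw [norm_mul, Complex.norm_real, Real.norm_eq_abs]
  exact mul_le_mul (hCF _) (abs_strObs_le r L q hCp (fun l => hCm (q l)) y U) (abs_nonneg _)
    ((norm_nonneg (F 0)).trans (hCF 0))

omit [IsTopologicalGroup G] [CompactSpace G] [BorelSpace G] in
/-- **Support of the smeared field**: if `F(a y) = 0` as soon as some site has `y_l⁰ ≤ 0`, the field depends only on
the links of `P ∪ M`. -/
theorem dependsOn_fieldObs (r : LatticeRep G) {L : ℕ} (hL : 1 ≤ L) (a : ℝ) {n : ℕ} (F : 𝓢((Fin n → E4), ℂ))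
    (hF : ∀ y : Fin n → Site 4, (∃ l, y l 0 ≤ 0) → F (fun l => a • siteToE (y l)) = 0) (m : Fin 4 × Fin 4 → ℝ) :
    DependsOn (fieldObs r L a F m)
      ((WilsonOddRP.oPosEdges ∪ WilsonOddRP.oSharedEdges : Finset (Edge 4 (2 * L + 1))) : Set (Edge 4 (2 * L + 1))) := by
  intro U V hUV
  unfold fieldObs
  refine Finset.sum_congr rfl fun q hq => Finset.sum_congr rfl fun y hy => ?_
  by_cases h0 : ∃ l, y l 0 ≤ 0
  · rw [hF y h0, zero_mul, zero_mul]
  · push Not at h0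
    have hyL : ∀ l, 1 ≤ y l 0 ∧ y l 0 ≤ L := fun l =>
      ⟨h0 l, ((mem_box.1 (Fintype.mem_piFinset.1 hy l)) 0).2⟩
    rw [dependsOn_strObs r hL ((mem_planeStrings_iff'' q).1 hq) _ hyL hUV]

/-- **The reflection-positivity square of finitely many smeared fields is non-negative**: for test functions
vanishing at non-positive times, `X = Σⱼ fieldObs a Fⱼ m` lives on the closed positive half of the odd torus, and
Osterwalder–Seiler reflection positivity (`wilsonExpectation_oddReflectionPositive`) gives
`0 ≤ Re E[conj X(ΘU) X(U)]`, `Im = 0`. -/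
theorem rpSquare_fieldObs_nonneg (r : LatticeRep G) {L : ℕ} (hL : 1 ≤ L) {β : ℝ} (hβ : 0 ≤ β) (a : ℝ)
    {N : ℕ} {deg : Fin N → ℕ} (F : (j : Fin N) → 𝓢((Fin (deg j) → E4), ℂ))
    (hF : ∀ j (y : Fin (deg j) → Site 4), (∃ l, y l 0 ≤ 0) → F j (fun l => a • siteToE (y l)) = 0)
    (m : Fin 4 × Fin 4 → ℝ) :
    let z := wilsonExpectation (d := 4) (L := 2 * L + 1) r.ρ β fun U =>
      conj (∑ j, fieldObs r L a (F j) m U.timeReflect) * ∑ j, fieldObs r L a (F j) m U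
    0 ≤ z.re ∧ z.im = 0 := by
  haveI : NeZero (2 * L + 1) := ⟨by omega⟩
  have hpos := wilsonExpectation_oddReflectionPositive (d := 4) (L := 2 * L + 1) (ρ := r.ρ) ⟨L, by ring⟩ (by omega)
    r.continuous hβ (fun U => ∑ j, fieldObs r L a (F j) m U)
    (Finset.measurable_sum _ fun j _ => measurable_fieldObs r L a (F j) m)
    (by
      choose C hC using fun j => exists_norm_fieldObs_le r L a (F j) m
      exact ⟨∑ j, C j, fun U => (norm_sum_le _ _).trans (Finset.sum_le_sum fun j _ => hC j U)⟩)
    (dependsOn_finset_sum' _ fun j _ => dependsOn_fieldObs r hL a (F j) (hF j) m)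
  exact ⟨(Complex.nonneg_iff.1 hpos).1, (Complex.nonneg_iff.1 hpos).2.symm⟩

end Summit.QuantumFields.YangMills.Theorems.OSLegsFromFemtoAndGap

end
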